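import Summits.BirchSwinnertonDyer.Rank1Residual.X12.O11.RouteUPrimeMember
import Summits.BirchSwinnertonDyer.Rank1Residual.Additive.QuadraticTwistBSDComparisonIsogeny
import HarnessLib

/-!
# ROUTE U — the ISOGENY CLASSES of the prime members: full BSD for every globally minimal curve
# `ℚ`-isogenous to a model of `49a1^{(−q)}` (Cassels' isogeny invariance BY NAME)

bsd-cm cell (run/shared/lean/pub/bsd-cm/), ROUTE U, seat `bsd-cm-ram`; planner's optional item (ii)
(STATUS 20:23:34Z). Each 𝒞₇ class `49a1^{(−q)}` has `ℚ`-isogenous companions (the twists of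
`49a2/49a3/49a4`: `j = −3375` or `16581375`, CM by `ℤ[(1+√−7)/2]` or `ℤ[√−7]`), all in 𝒞₇ with the same
`L`-function. Miller's `BSD(E,p)` is an isogeny invariant in analytic rank `≤ 1` granted Cassels' theorem
(sibling cell, `Additive.TwistComparison.bsdp_of_bsdp_of_isIsogenous`, named fact
`bsdRHS_eq_of_isIsogenous` = Cassels 1965 / Milne ADT I.7.3, + GZK + modularity). Composing with the
prime-member class theorem `RouteU.forall_bsdp_of_twist_cm7_prime`:

* `forall_bsdp_of_isIsogenous_twist_cm7_prime` — with the inputs of `forall_bsdp_of_twist_cm7_prime` for a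
  globally minimal model `W` of `49a1^{(−q)}` ((−7/q) = 1, `r_an = 1`, certificates, named facts, data),
  Cassels' named fact `hCassels`, and a `ℚ`-isogeny `W ∼ W'` to a globally minimal elliptic `W'`:
  `BSD(W', p)` at EVERY prime `p`.

THEOREMS ONLY; no new named fact (Cassels' is the sibling cell's `bsdRHS_eq_of_isIsogenous`); nothing booked.
References: [Cassels1965ArithmeticVIII]; [MilneADT2006] Thm. I.7.3; [Miller2011LMS] §1, Def. 1.1.
-/

noncomputable section

open scoped Classical
open NumberField WeierstrassCurve DirichletCharacter
open Literature.NumberTheory.EllipticCurves Literature.NumberTheory.EllipticCurves.Rank1Residual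
open Literature.NumberTheory.EllipticCurves.KrizLi2019 Literature.NumberTheory.LFunctions
open Literature.NumberTheory.EllipticCurves.ModularForms
open Summit.BirchSwinnertonDyer.Rank1Residual.Additive (TwistComparison.bsdp_of_bsdp_of_isIsogenous)

namespace Summit.BirchSwinnertonDyer.Rank1Residual.X12.O11.RouteU

/-- **ROUTE U ⇒ FULL BSD on the ISOGENY CLASS of a prime member.** With the inputs of
`forall_bsdp_of_twist_cm7_prime` for a globally minimal model `W` of `49a1^{(−q)}` (`q ≡ 3 (4)` prime,
`q ≠ 7`, `(−7/q) = 1`, `r_an(W) = 1`), Cassels' isogeny invariance of the BSD quotient BY NAME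
(`hCassels : bsdRHS_eq_of_isIsogenous`) and a `ℚ`-isogeny `hiso : IsIsogenous W W'` to a globally minimal
elliptic `W'`: Miller's `BSD(W', p)` holds at EVERY prime `p`
(`Additive.TwistComparison.bsdp_of_bsdp_of_isIsogenous`, sibling cell b2b-bsdres).
[cite: Miller2011LMS, §1 and Def. 1.1] [cite: Cassels1965ArithmeticVIII] [cite: MilneADT2006, Thm. I.7.3] -/
theorem forall_bsdp_of_isIsogenous_twist_cm7_prime {q r : ℕ} [hq : Fact q.Prime] [hr : Fact r.Prime]
    (hq4 : q % 4 = 3) (hr4 : r % 4 = 3) (hq7 : q ≠ 7) (hr7 : r ≠ 7) (hr3 : r ≠ 3) (hqr : q ≠ r)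
    (h7split : legendreSym 7 (-(r : ℤ)) = 1) (hqsplit : legendreSym q (-(r : ℤ)) = 1)
    (hsq : legendreSym q (-7) = 1)
    (hcert₁ : ∀ (ω : DirichletCharacter ℚ_[7] 7), IsTeichmullerCharacter ω →
      ∀ θ : DirichletCharacter ℚ_[7] (7 * q),
        (∀ j : ZMod (7 * q), θ j = (legendreSym q (j.val : ℤ) : ℚ_[7]) * ω (j.val : ZMod 7) ^ 4) →
        ‖generalizedBernoulli 1 θ‖ = 1)
    (hcert₂ : ∀ (ω : DirichletCharacter ℚ_[7] 7), IsTeichmullerCharacter ω →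
      ∀ θ : DirichletCharacter ℚ_[7] (7 * q * r),
        (∀ j : ZMod (7 * q * r), θ j =
          ((legendreSym q (j.val : ℤ) * jacobiSym (j.val : ℤ) r : ℤ) : ℚ_[7]) * ω (j.val : ZMod 7) ^ 1) →
        ‖generalizedBernoulli 1 θ‖ = 1)
    (hKL : KrizLi2019.thm120_padicLogHeegner_unit_of_bernoulli)
    (hRem : KrizLi2019.rem310_padicLogHeegner_integral)
    (W : WeierstrassCurve ℚ) [W.IsElliptic] [W.IsGloballyMinimal] [NeZero (W.conductorNorm ℤ)]
    (hW : ∃ C : VariableChange ℚ, C • W = cm7.quadraticTwist ((-(q : ℤ) : ℤ) : ℚ))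
    (K : Type) [Field K] [NumberField K] [NeZero (NumberField.discr K).natAbs]
    (hK : IsImaginaryQuadratic K) (hdK : NumberField.discr K = -(r : ℤ))
    (D : ModularParametrizationData W (W.conductorNorm ℤ))
    (H : HeegnerDatum (W.conductorNorm ℤ) (NumberField.discr K)) (ι : K →+* ℂ) (ιp : K →+* ℚ_[7])
    (P : (W.baseChange K).toAffine.Point)
    (hGZ : gross_zagier (W.conductorNorm ℤ) W K) (hKo : kolyvagin (W.conductorNorm ℤ) W K)
    (hGZK : rank_eq_analyticRank_of_analyticRank_le_one) (hmod : hasEntireLFunction_rat)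
    (hP : WeierstrassCurve.Affine.Point.map ι.toRatAlgHom P = heegnerPointComplex D H)
    (hr1 : W.analyticRank = 1)
    (hLt : (W.quadraticTwist (NumberField.discr K : ℚ)).entireLFunction 1 ≠ 0)
    (Wd : WeierstrassCurve ℚ) [Wd.IsElliptic] [Wd.IsGloballyMinimal] (Cd : VariableChange ℚ)
    (hWd : Cd • W.quadraticTwist (NumberField.discr K : ℚ) = Wd)
    (hBF : bsdTriple_of_hasCM_of_L_one_ne_zero)
    (hu : padicValRat 7 (Cd.u : ℚ) = 0)
    (hC : Rubin1983.thmC_seven_quadraticField)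
    (hBG : BuhlerGross1985.firstDescent_seven_oddTwist_of_bernoulli)
    [Finite (AddCommGroup.torsion (W.baseChange K).toAffine.Point)]
    (crd : (W.baseChange K).toAffine.Point →+ ℤ) (g : (W.baseChange K).toAffine.Point)
    (hg : crd g = 1) (hker : ∀ x, crd x = 0 → IsOfFinAddOrder x)
    (hc7 : ¬ ((7 : ℤ) ∣ D.c)) (hLLT : LiLiuTian2024.thm11_bsdp_of_cm_rank_one)
    (hKob : Kobayashi2013.cor14_bsdp_of_cm_rank_one) (hLTYZ : LiTianYanZhu2025.thm11_bsdp_of_cm_rank_one)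
    (hCassels : bsdRHS_eq_of_isIsogenous) (W' : WeierstrassCurve ℚ) [W'.IsElliptic] [W'.IsGloballyMinimal]
    (hiso : IsIsogenous W W') :
    ∀ p : ℕ, p.Prime → BSDp W' p := fun p hp =>
  haveI := Fact.mk hp
  TwistComparison.bsdp_of_bsdp_of_isIsogenous W W' p hCassels hGZK hmod hiso hr1.le
    (forall_bsdp_of_twist_cm7_prime hq4 hr4 hq7 hr7 hr3 hqr h7split hqsplit hsq hcert₁ hcert₂ hKL hRem W
      hW K hK hdK D H ι ιp P hGZ hKo hGZK hmod hP hr1 hLt Wd Cd hWd hBF hu hC hBG crd g hg hker hc7 hLLT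
      hKob hLTYZ p hp)

end Summit.BirchSwinnertonDyer.Rank1Residual.X12.O11.RouteU

end
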